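/-
Copyright: rh-split cell (screw, prover seat l22-w3) gen 0, 2026-08-27.  Route-independent home
(no `Summits` import) of the NEGATIVE-PART form of the robust Landau door for Suzuki's screw
function.  Every statement is a detection theorem / RH-equivalence for `ζ`'s own screw function;
an RH-equivalence is bookkeeping, not progress on RH; nothing here bears on the truth of RH.
-/
import Literature.NumberTheory.LFunctions.ZetaScrewSlackLandau
import HarnessLib

/-!
# The negative-part (`L¹`) Landau door: `RH ⟺ Ψ⁻ ∈ L¹(0, ∞)`

`Ψ = zetaScrew` is Suzuki's screw function of `ζ` ([Suzuki2023] (1.1)) and `Ψ⁻ = max(-Ψ, 0)` its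
negative part.  [Suzuki2023] Thm 1.6: RH ⟺ `Ψ = O(1)` on `[0, ∞)`; Thm 1.7: RH ⟺ `Ψ ≥ 0`; and
(remark after Thm 1.6) `Ψ` itself lies in NEITHER `L¹(0,∞)` nor `L²(0,∞)`, whether or not RH holds.
The tree's slack door `ZetaScrewLandau.quasiRiemannHypothesis_of_zetaScrew_ge_neg_slack`
(ZetaScrewSlackLandau.lean: `Ψ ≥ -D` on `[0,∞)` with `D ≥ 0` measurable and `D·e^{-βt} ∈ L¹(0,∞)`,
`β ≥ 0` ⟹ `QuasiRiemannHypothesis (1/2 + β)`) specialised to the smallest admissible slack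
`D = Ψ⁻` gives:

* `quasiRiemannHypothesis_of_integrable_negPart` — `Ψ⁻·e^{-βt} ∈ L¹(0,∞)`, `β ≥ 0` ⟹ no zero of
  `ζ` with `1/2 + β < Re s < 1`;
* `riemannHypothesis_of_integrable_negPart` — **`∫₀^∞ Ψ⁻(t) dt < ∞ ⟹ RH`** (`β = 0` and
  `QuasiRH(1/2) ⟺ RH`, `quasiRiemannHypothesis_one_half_iff_holds`), and the weighted variant
  `riemannHypothesis_of_integrable_negPart_weight` (`Ψ⁻·e^{-σ₀t} ∈ L¹` for some `σ₀ ≤ 0`);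
* `riemannHypothesis_iff_integrable_negPart` — **RH ⟺ `Ψ⁻ ∈ L¹(0,∞)`** (⟸ above; ⟹ because
  `Ψ⁻ ≡ 0` under RH, Thm 1.7 / tree `ZetaScrewThm17.zetaScrew_nonneg_of_RH`).

So although `Ψ ∉ L¹(0,∞)` unconditionally, integrability of its NEGATIVE PART alone is exactly RH:
the `L¹` endpoint between the pointwise criterion (Thm 1.7) and the bounded-below criterion
(tree `riemannHypothesis_of_zetaScrew_ge_neg_const`, the nontrivial half of Thm 1.6).  These
corollaries are not stated in [Suzuki2023]; the method is §7.2 there (Laplace transform of `Ψ` +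
Landau's theorem on Dirichlet integrals with nonnegative integrand).  No `sorry`; axioms standard.
-/

noncomputable section

namespace Literature.NumberTheory.LFunctions

namespace ZetaScrewLandau

open _root_.MeasureTheory _root_.Set

/-- The negative part `Ψ⁻ = max(-Ψ, 0)` of the screw function is measurable (indeed continuous,
`continuous_zetaScrew`). [cite: Suzuki2023, (1.1)] -/
theorem measurable_negPart_zetaScrew : Measurable fun t : ℝ ↦ max (-zetaScrew t) 0 :=
  (continuous_zetaScrew.neg.max continuous_const).measurable

/-- **Graded negative-part door.**  If `Ψ⁻·e^{-βt}` is integrable on `(0, ∞)` for some `β ≥ 0`,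
then `ζ` has no zero with `1/2 + β < Re s < 1` (`QuasiRiemannHypothesis (1/2 + β)`): the slack
door `quasiRiemannHypothesis_of_zetaScrew_ge_neg_slack` with the smallest admissible slack
`D = Ψ⁻` (`Ψ ≥ -Ψ⁻` trivially).  Method of [Suzuki2023] §7.2; not stated there.
[cite: Suzuki2023, §7.2 (method of proof of Thm 1.7)] -/
theorem quasiRiemannHypothesis_of_integrable_negPart {β : ℝ} (hβ : 0 ≤ β)
    (h : IntegrableOn (fun t : ℝ ↦ max (-zetaScrew t) 0 * Real.exp (-β * t)) (Ioi 0)) :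
    QuasiRiemannHypothesis (1 / 2 + β) :=
  quasiRiemannHypothesis_of_zetaScrew_ge_neg_slack measurable_negPart_zetaScrew hβ h
    (fun t _ ↦ by linarith [le_max_left (-zetaScrew t) 0])

/-- **The `L¹` door: `∫₀^∞ Ψ⁻(t) dt < ∞ ⟹ RH`.**  Integrability of the negative part of the screw
function on `(0, ∞)` implies the Riemann hypothesis (`β = 0` in the graded door, then
`QuasiRH(1/2) ⟺ RH` by the functional equation, `quasiRiemannHypothesis_one_half_iff_holds`).
RH-free detection theorem; method of [Suzuki2023] §7.2, not stated there.
[cite: Suzuki2023, §7.2 (method of proof of Thm 1.7)] -/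
theorem riemannHypothesis_of_integrable_negPart
    (h : IntegrableOn (fun t : ℝ ↦ max (-zetaScrew t) 0) (Ioi 0)) : RiemannHypothesis := by
  have h' : IntegrableOn (fun t : ℝ ↦ max (-zetaScrew t) 0 * Real.exp (-0 * t)) (Ioi 0) := by
    simpa using h
  have hq := quasiRiemannHypothesis_of_integrable_negPart le_rfl h'
  rw [add_zero] at hq
  exact quasiRiemannHypothesis_one_half_iff_holds.1 hq

/-- **Weighted `L¹` door.**  If `Ψ⁻·e^{-σ₀t}` is integrable on `(0, ∞)` for some `σ₀ ≤ 0`, then RH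
(the weight is `≥ 1` on `(0,∞)`, so `Ψ⁻` itself is integrable).  Method of [Suzuki2023] §7.2, not
stated there. [cite: Suzuki2023, §7.2 (method of proof of Thm 1.7)] -/
theorem riemannHypothesis_of_integrable_negPart_weight {σ₀ : ℝ} (hσ₀ : σ₀ ≤ 0)
    (h : IntegrableOn (fun t : ℝ ↦ max (-zetaScrew t) 0 * Real.exp (-σ₀ * t)) (Ioi 0)) :
    RiemannHypothesis := by
  refine riemannHypothesis_of_integrable_negPart (Integrable.mono' h ?_ ?_)
  · exact measurable_negPart_zetaScrew.aestronglyMeasurable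
  · filter_upwards [ae_restrict_mem measurableSet_Ioi] with t ht
    have h0 : 0 ≤ max (-zetaScrew t) 0 := le_max_right _ _
    have h1 : 1 ≤ Real.exp (-σ₀ * t) :=
      Real.one_le_exp (mul_nonneg (neg_nonneg.mpr hσ₀) (le_of_lt ht))
    rw [Real.norm_eq_abs, abs_of_nonneg h0]
    nlinarith

/-- Under RH the negative part of the screw function vanishes identically (`Ψ ≥ 0`,
[Suzuki2023] Thm 1.7, tree `ZetaScrewThm17.zetaScrew_nonneg_of_RH`). [cite: Suzuki2023, Thm 1.7] -/
theorem negPart_zetaScrew_eq_zero_of_riemannHypothesis (hRH : RiemannHypothesis) (t : ℝ) :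
    max (-zetaScrew t) 0 = 0 :=
  max_eq_right (by linarith [ZetaScrewThm17.zetaScrew_nonneg_of_RH hRH t])

/-- **RH ⟺ `Ψ⁻ ∈ L¹(0, ∞)`.**  The Riemann hypothesis holds iff the negative part of Suzuki's screw
function is integrable on `(0, ∞)` (⟹: `Ψ⁻ ≡ 0` under RH; ⟸: the `L¹` door).  Compare
[Suzuki2023] Thm 1.6 (RH ⟺ `Ψ` bounded), Thm 1.7 (RH ⟺ `Ψ ≥ 0`) and the remark after Thm 1.6 that
`Ψ ∉ L¹(0,∞)` unconditionally.  An RH-EQUIVALENCE — bookkeeping, not progress on RH.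
[cite: Suzuki2023, Thm 1.7 and §7.2 (method)] -/
theorem riemannHypothesis_iff_integrable_negPart :
    RiemannHypothesis ↔ IntegrableOn (fun t : ℝ ↦ max (-zetaScrew t) 0) (Ioi 0) := by
  refine ⟨fun hRH ↦ ?_, riemannHypothesis_of_integrable_negPart⟩
  have h0 : (fun t : ℝ ↦ max (-zetaScrew t) 0) = fun _ ↦ 0 :=
    funext (negPart_zetaScrew_eq_zero_of_riemannHypothesis hRH)
  rw [h0]
  exact integrableOn_zero

end ZetaScrewLandau

end Literature.NumberTheory.LFunctions

end
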